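import Summits.HodgeConjecture.HodgeConjecture.Theorems.MarkmanPartnerTransportPicardThreeK3SquaresKugaSatakePairSimilitude
import Summits.HodgeConjecture.HodgeConjecture.Theorems.MarkmanPartnerTransportPicardThreeK3SquaresSimilitudeInvariance
import Summits.HodgeConjecture.HodgeConjecture.Theorems.MarkmanPartnerTransportKugaSatakeSimilitudeVarescoFree

/-!
# Route MarkmanPartnerTransport · crux `PicardThreeK3Squares` (stmt-HodgeConjecture-19652) —
# SIMILITUDE INVARIANCE OF HC⁴ FOR K3 SQUARES ALONG RATIONAL HODGE SIMILITUDES OF ANY MULTIPLIER,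
# granted the Kuga–Satake statements for both surfaces

Gen 3 (`…IsogenyInvariance`, mod Buskin) made HC⁴(S ⊗ S) an invariant of the rational Hodge ISOMETRY class
of `T(S)_ℚ`; gen 5 (`…SimilitudeInvariance`) added the similitudes of multiplier `2` (`ρ ≥ 11`) and `3`
(`ρ ≥ 15`) along Varesco's quotient data. With the two-surface Kuga–Satake theorem of gen 15
(`KugaSatakePair.exists_algebraicCorrespondence_eq_of_similitude_of_kugaSatake₂`, Varesco's Thm. 5.3 in the
kernel) every rational Hodge similitude `ψ : T(Y) ↠ T(S)` of ANY multiplier `m` between marked projective K3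
surfaces with algebraic Kuga–Satake correspondences is the action of an algebraic class, hence a DATUM in the
sense of `…QuotientDescent`, and HC⁴ transports both ways (`QuotientSimilitude.hodgeConjectureFor_square_iff_of_datum`):

* `traceC_cupProduct_eq_of_marking` — `∫ a ∪ b = (ηa · ηb) · ∫ p` for a marking `(η, p)`.
* `exists_datum_of_similitude_of_kugaSatake` — `ψ = [γ']_*` everywhere for an algebraic `γ'` on `S ⊗ Y`
  (the theorem on `T(Y)`, then `exists_corr_eq_of_eq_on_transcendental` through the transcendental projector).
* `hodgeConjectureFor_square_iff_of_similitude_of_kugaSatake` — **HC⁴(Y ⊗ Y) ⟺ HC⁴(S ⊗ S) for marked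
  projective K3 surfaces related by a rational Hodge similitude of any multiplier, GRANTED the Kuga–Satake
  statements for `S` and `Y`**: modulo Kuga–Satake the open residue of the crux is a union of SIMILITUDE
  classes of transcendental lattices (not only isometry classes).

CONDITIONAL on the two Kuga–Satake hypotheses (open in print); no named fact, no definition, no sorry;
nothing here says HC or the crux is proved. Prover seat hodge-nonav-19652-p1 (gen 15),
`--supports stmt-HodgeConjecture-19652`.

References: M. Varesco, Math. Z. 305 (2023), Thm. 5.3, §2 (p. 8); D. Huybrechts, Comment. Math. Helv. 94
(2019), Thm. 0.2; W. Fulton, *Intersection Theory*, §16.1 Prop. 16.1.1.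
-/

set_option linter.dupNamespace false

noncomputable section

namespace Summit.HodgeConjecture.HodgeConjecture.Theorems.MarkmanPartnerTransport.KugaSatakePair

open scoped Manifold
open Module CategoryTheory MonoidalCategory CartesianMonoidalCategory
open Literature.AlgebraicGeometry Literature.AlgebraicGeometry.Motives Literature.AlgebraicGeometry.HodgeTheory
open Literature.AlgebraicGeometry.Surfaces
open Literature.AlgebraicTopology.SingularHomology
open Summit.HodgeConjecture.HodgeConjecture.Theorems
open Summit.HodgeConjecture.HodgeConjecture.Theorems.MarkmanPartnerTransport
open Summit.HodgeConjecture.HodgeConjecture.Ring2.AbelianAll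

variable {S Y : SchemeOver ℂ}

/-- `MarkedK3[S, η, p, x]`: VERBATIM the `let MarkedK3 := …` binder of the route declaration
`PicardThreeK3Squares`. Local notation only. -/
local notation3 (prettyPrint := false) "MarkedK3[" S ", " η ", " p ", " x "]" =>
  (p ≠ 0 ∧ (IsIntegralClass p ∧
    (∀ q : complexBetti S (2 * 2), IsIntegralClass q → ∃ n : ℤ, q = n • p) ∧
    (∀ c : complexBetti S (2 * 1), IsIntegralClass c ↔ ∃ v : K3Index → ℤ, η c = fun i => (v i : ℂ)) ∧
    (∀ a b : complexBetti S (2 * 1),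
      cupProduct (rfl : 2 * 1 + 2 * 1 = 2 * 2) a b = k3Form (η a) (η b) • p) ∧
    IsOfHodgeType 2 S (2 * 1) 2 0 (LinearEquiv.symm η x) ∧
    (∀ τ : complexBetti S (2 * 1), IsOfHodgeType 2 S (2 * 1) 2 0 τ →
      ∃ t : ℂ, τ = t • LinearEquiv.symm η x)) ∧
    (k3Form x x = 0 ∧ 0 < (k3Form (star x) x).re ∧
      ∃ u : K3Index → ℤ, k3Form (fun i => (u i : ℂ)) x = 0 ∧ 0 < ∑ i, ∑ j, u i * k3Gram i j * u j))

/-- `Corr[μ, X, Y, hX, hY ; γ, y] = fst_* (snd^* y ∪ γ)` (`hX hY : IsSmoothProjective 2 _`). Local notation only. -/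
local notation3 (prettyPrint := false) "Corr[" μ ", " X ", " Y ", " hX ", " hY " ; " γ ", " y "]" =>
  complexGysin μ (IsSmoothProjective.tensor_holds hX hY) hX (SemiCartesianMonoidalCategory.fst X Y)
    (rfl : 2 * 1 + 2 * 2 + 2 * 2 = 2 * 1 + 2 * (2 + 2))
    (cupProduct (rfl : 2 * 1 + 2 * 2 = 2 * 1 + 2 * 2)
      (complexBetti.map (SemiCartesianMonoidalCategory.snd X Y) (2 * 1) y) γ)

/-- `Datum[X, Z, hX, hZ, η, ηZ ; γ, m]` (VERBATIM `…QuotientDescent`): `γ` is an algebraic class on `X ⊗ Z`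
whose action is rational, Hodge-type preserving, maps `T(Z)` onto `T(X)` and scales the forms there by `m` in
the markings. Local notation only. -/
local notation3 (prettyPrint := false) "Datum[" X ", " Z ", " hX ", " hZ ", " η ", " ηZ " ; " γ ", " m "]" =>
  (γ ∈ algebraicClasses (X ⊗ Z) 2 ∧
    (∀ y, IsRationalClass y → IsRationalClass (Corr[complexOrientationFamily, X, Z, hX, hZ ; γ, y])) ∧
    (∀ (i j : ℕ) y, IsOfHodgeType 2 Z (2 * 1) i j y →
      IsOfHodgeType 2 X (2 * 1) i j (Corr[complexOrientationFamily, X, Z, hX, hZ ; γ, y])) ∧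
    (∀ y ∈ transcendentalSubspace Z,
      Corr[complexOrientationFamily, X, Z, hX, hZ ; γ, y] ∈ transcendentalSubspace X) ∧
    (∀ z ∈ transcendentalSubspace X, ∃ y ∈ transcendentalSubspace Z,
      Corr[complexOrientationFamily, X, Z, hX, hZ ; γ, y] = z) ∧
    (∀ a ∈ transcendentalSubspace Z, ∀ b ∈ transcendentalSubspace Z,
      k3Form (η (Corr[complexOrientationFamily, X, Z, hX, hZ ; γ, a]))
        (η (Corr[complexOrientationFamily, X, Z, hX, hZ ; γ, b])) = m * k3Form (ηZ a) (ηZ b)))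

/-- `Transc[S, y]`: `y` is cup-orthogonal to `N¹(S)`. Local notation only. -/
local notation3 (prettyPrint := false) "Transc[" S ", " y "]" =>
  (∀ d ∈ algebraicClasses S 1, cupProduct (rfl : 2 * 1 + 2 * 1 = 2 * 2) y d = 0)

/-! ### §1 The intersection form through a marking -/

/-- **`∫_S a ∪ b = (ηa · ηb) · ∫_S p`** for a marking `(η, p)` of a smooth projective surface
(`a ∪ b = (ηa · ηb) • p`). [cite: Huybrechts2016K3, Ch. 1 §3.3 and Ch. 3 §1.1] -/
theorem traceC_cupProduct_eq_of_marking (hS : IsSmoothProjective 2 S)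
    {η : complexBetti S (2 * 1) ≃ₗ[ℂ] (K3Index → ℂ)} {p : complexBetti S (2 * 2)}
    (hcup : ∀ a b : complexBetti S (2 * 1), cupProduct (rfl : 2 * 1 + 2 * 1 = 2 * 2) a b = k3Form (η a) (η b) • p)
    (a b : complexBetti S (2 * 1)) :
    traceC hS (cupProduct (rfl : 2 * 1 + 2 * 1 = 2 * 2) a b) = k3Form (η a) (η b) * traceC hS p := by
  rw [hcup a b, map_smul, smul_eq_mul]

/-! ### §2 A Kuga–Satake-conditional similitude is a datum -/

/-- **A rational Hodge similitude `ψ : T(Y) ↠ T(S)` of ANY multiplier is the action of an algebraic class on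
`S ⊗ Y`, granted Kuga–Satake for `S` and `Y`.** Data: marked projective K3 surfaces `(S, η, p, x)`,
`(Y, η_Y, p_Y, x_Y)` with algebraic Kuga–Satake correspondences (HYPOTHESES), `ψ : H²(Y(ℂ); ℂ) → H²(S(ℂ); ℂ)`
rational, type-preserving, killing `N¹(Y)`, with values in `T(S)_ℂ`, injective on `T(Y)_ℂ` and onto `T(S)_ℂ`,
and `(ηψa · ηψb) = m (η_Y a · η_Y b)` on `T(Y)_ℂ`, `m ∈ ℚˣ`. Then `ψ = [γ']_*` EVERYWHERE for an algebraic `γ'`,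
which is a datum for `S` from `Y` of multiplier `m`. [cite: Varesco2023, Thm. 5.3 and §2 (p. 8)]
[cite: Fulton1998, §16.1 Prop. 16.1.1] -/
theorem exists_datum_of_similitude_of_kugaSatake (hS : IsK3Surface S)
    (η : complexBetti S (2 * 1) ≃ₗ[ℂ] (K3Index → ℂ)) (p : complexBetti S (2 * 2)) (x : K3Index → ℂ)
    (hM : MarkedK3[S, η, p, x]) (hY : IsK3Surface Y)
    (ηY : complexBetti Y (2 * 1) ≃ₗ[ℂ] (K3Index → ℂ)) (pY : complexBetti Y (2 * 2)) (xY : K3Index → ℂ)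
    (hMY : MarkedK3[Y, ηY, pY, xY])
    (hKS : IsKSCorrespondenceAlgebraicBetti hS.isSmoothProjective)
    (hKSY : IsKSCorrespondenceAlgebraicBetti hY.isSmoothProjective)
    (ψ : complexBetti Y (2 * 1) →ₗ[ℂ] complexBetti S (2 * 1))
    (h1 : ∀ y, IsRationalClass y → IsRationalClass (ψ y))
    (h2 : ∀ (i j : ℕ) y, IsOfHodgeType 2 Y (2 * 1) i j y → IsOfHodgeType 2 S (2 * 1) i j (ψ y))
    (h3 : ∀ d ∈ algebraicClasses Y 1, ψ d = 0)
    (h4 : ∀ y : complexBetti Y (2 * 1), Transc[S, ψ y])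
    (hinj : ∀ y : complexBetti Y (2 * 1), Transc[Y, y] → ψ y = 0 → y = 0)
    (hsurj : ∀ z : complexBetti S (2 * 1), Transc[S, z] → ∃ y, Transc[Y, y] ∧ ψ y = z)
    {m : ℚ} (hm : m ≠ 0)
    (hiso : ∀ a b : complexBetti Y (2 * 1), Transc[Y, a] → Transc[Y, b] →
      k3Form (η (ψ a)) (η (ψ b)) = (m : ℂ) * k3Form (ηY a) (ηY b)) :
    ∃ γ' : complexBetti (S ⊗ Y) (2 * 2), Datum[S, Y, hS.1, hY.1, η, ηY ; γ', (m : ℂ)] := by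
  have hX := hS.isSmoothProjective
  have hXY := hY.isSmoothProjective
  have hσ0 := KugaSatakeSimilitude.marking_symm_ne_zero hM
  have hσY0 := KugaSatakeSimilitude.marking_symm_ne_zero hMY
  obtain ⟨hp0, ⟨-, -, -, hcup, hx20, hline⟩, -⟩ := hM
  obtain ⟨hpY0, ⟨-, -, -, hcupY, hxY20, hlineY⟩, -⟩ := hMY
  -- the multiplier in trace form
  have hτ : traceC hX p ≠ 0 := fun h0 => hp0 (eq_zero_of_traceC_eq_zero hX h0)
  have hτY : traceC hXY pY ≠ 0 := fun h0 => hpY0 (eq_zero_of_traceC_eq_zero hXY h0)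
  have hmul : ∀ a b : complexBetti Y (2 * 1), Transc[Y, a] → Transc[Y, b] →
      traceC hX (cupProduct (rfl : 2 * 1 + 2 * 1 = 2 * 2) (ψ a) (ψ b)) =
        ((m : ℂ) * traceC hX p * (traceC hXY pY)⁻¹) * traceC hXY (cupProduct (rfl : 2 * 1 + 2 * 1 = 2 * 2) a b) := by
    intro a b ha hb
    rw [traceC_cupProduct_eq_of_marking hX hcup, traceC_cupProduct_eq_of_marking hXY hcupY, hiso a b ha hb]
    field_simp
  have hμ : ((m : ℂ) * traceC hX p * (traceC hXY pY)⁻¹) ≠ 0 :=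
    mul_ne_zero (mul_ne_zero (by exact_mod_cast hm) hτ) (inv_ne_zero hτY)
  -- the two-surface Kuga–Satake theorem (source `Y`, target `S`)
  obtain ⟨Φ, hΦ, hΦψ⟩ := exists_algebraicCorrespondence_eq_of_similitude_of_kugaSatake₂ hXY hX hxY20 hσY0 hlineY
    hx20 hσ0 hline hKSY hKS ψ h1 h2 h4 hinj hsurj hμ hmul
  -- as the action of an algebraic class, on `T(Y)` and then everywhere
  obtain ⟨e, hab, γ, hγ, hΦγ⟩ := IsAlgebraicCorrespondence.exists_eq_corrAction hX hXY hΦ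
  obtain rfl : e = 2 := by omega
  have hγT : ∀ y ∈ transcendentalSubspace Y, Corr[complexOrientationFamily, S, Y, hS.1, hY.1 ; γ, y] = ψ y := by
    intro y hy
    rw [← hΦψ y ((mem_transcendentalSubspace_iff_forall_algebraicClasses hXY y).1 hy), hΦγ]
    rfl
  obtain ⟨γ', hγ'alg, hγ'⟩ := QuotientSimilitude.exists_corr_eq_of_eq_on_transcendental hS hY ψ h3 hγ hγT
  refine ⟨γ', hγ'alg, fun y hy => ?_, fun i j y hy => ?_, fun y _ => ?_, fun z hz => ?_, fun a ha b hb => ?_⟩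
  · rw [hγ' y]; exact h1 y hy
  · rw [hγ' y]; exact h2 i j y hy
  · rw [hγ' y]; exact (mem_transcendentalSubspace_iff_forall_algebraicClasses hX _).2 (h4 y)
  · obtain ⟨y, hy, hyz⟩ := hsurj z ((mem_transcendentalSubspace_iff_forall_algebraicClasses hX z).1 hz)
    exact ⟨y, (mem_transcendentalSubspace_iff_forall_algebraicClasses hXY y).2 hy, by rw [hγ' y, hyz]⟩
  · rw [hγ' a, hγ' b]
    exact hiso a b ((mem_transcendentalSubspace_iff_forall_algebraicClasses hXY a).1 ha)
      ((mem_transcendentalSubspace_iff_forall_algebraicClasses hXY b).1 hb)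

/-! ### §3 Similitude invariance of HC⁴, any multiplier, granted Kuga–Satake -/

/-- **HC⁴(Y ⊗ Y) ⟺ HC⁴(S ⊗ S) along a rational Hodge similitude of ANY multiplier, granted the Kuga–Satake
statements for `S` and `Y`.** Data: marked projective K3 surfaces `(S, η, p, x)`, `(Y, η_Y, p_Y, x_Y)` whose
Kuga–Satake correspondences are algebraic (`IsKSCorrespondenceAlgebraicBetti`, HYPOTHESES, open in print),
and `ψ : H²(Y(ℂ); ℂ) → H²(S(ℂ); ℂ)` rational, Hodge-type preserving, killing `N¹(Y)`, mapping `T(Y)_ℂ`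
injectively onto `T(S)_ℂ` with `(ηψa · ηψb) = m (η_Y a · η_Y b)` there, `m ∈ ℚˣ`. Then the Hodge conjecture
for `Y × Y` is EQUIVALENT to the Hodge conjecture for `S × S` (`ψ` is a datum by
`exists_datum_of_similitude_of_kugaSatake`; `QuotientSimilitude.hodgeConjectureFor_square_iff_of_datum`).
Granted Kuga–Satake, the open residue of the crux is a union of SIMILITUDE classes of `T(S)_ℚ`.
CONDITIONAL; credits nothing to HC. [cite: Varesco2023, Thm. 5.3 and §2 (p. 8)] [cite: Huybrechts2019, Thm. 0.2]
[cite: Fulton1998, §16.1 Prop. 16.1.1] -/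
theorem hodgeConjectureFor_square_iff_of_similitude_of_kugaSatake (hS : IsK3Surface S)
    (η : complexBetti S (2 * 1) ≃ₗ[ℂ] (K3Index → ℂ)) (p : complexBetti S (2 * 2)) (x : K3Index → ℂ)
    (hM : MarkedK3[S, η, p, x]) (hY : IsK3Surface Y)
    (ηY : complexBetti Y (2 * 1) ≃ₗ[ℂ] (K3Index → ℂ)) (pY : complexBetti Y (2 * 2)) (xY : K3Index → ℂ)
    (hMY : MarkedK3[Y, ηY, pY, xY])
    (hKS : IsKSCorrespondenceAlgebraicBetti hS.isSmoothProjective)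
    (hKSY : IsKSCorrespondenceAlgebraicBetti hY.isSmoothProjective)
    (ψ : complexBetti Y (2 * 1) →ₗ[ℂ] complexBetti S (2 * 1))
    (h1 : ∀ y, IsRationalClass y → IsRationalClass (ψ y))
    (h2 : ∀ (i j : ℕ) y, IsOfHodgeType 2 Y (2 * 1) i j y → IsOfHodgeType 2 S (2 * 1) i j (ψ y))
    (h3 : ∀ d ∈ algebraicClasses Y 1, ψ d = 0)
    (h4 : ∀ y : complexBetti Y (2 * 1), Transc[S, ψ y])
    (hinj : ∀ y : complexBetti Y (2 * 1), Transc[Y, y] → ψ y = 0 → y = 0)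
    (hsurj : ∀ z : complexBetti S (2 * 1), Transc[S, z] → ∃ y, Transc[Y, y] ∧ ψ y = z)
    {m : ℚ} (hm : m ≠ 0)
    (hiso : ∀ a b : complexBetti Y (2 * 1), Transc[Y, a] → Transc[Y, b] →
      k3Form (η (ψ a)) (η (ψ b)) = (m : ℂ) * k3Form (ηY a) (ηY b)) :
    HodgeConjectureFor 4 (Y ⊗ Y) ↔ HodgeConjectureFor 4 (S ⊗ S) := by
  obtain ⟨γ', hD⟩ := exists_datum_of_similitude_of_kugaSatake hS η p x hM hY ηY pY xY hMY hKS hKSY ψ h1 h2 h3 h4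
    hinj hsurj hm hiso
  exact QuotientSimilitude.hodgeConjectureFor_square_iff_of_datum hS η p x hM hY ηY pY xY hMY
    (by exact_mod_cast hm : ((m : ℚ) : ℂ) ≠ 0) ⟨m, rfl⟩ γ' hD

end Summit.HodgeConjecture.HodgeConjecture.Theorems.MarkmanPartnerTransport.KugaSatakePair

end
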